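import Summits.QuantumFields.YangMills.Theorems.BalabanUVNodesPortS1LZjacReg
import Summits.QuantumFields.YangMills.Theorems.BalabanUVNodesPortS1LZdetReg
import Summits.QuantumFields.YangMills.Theorems.BalabanUVNodesPortS1G3CPointwise
import Summits.QuantumFields.YangMills.Theorems.BalabanUVNodesPortS1ClassRegDefs
import Summits.QuantumFields.YangMills.Theorems.BalabanUVNodesPortRecordRepresentationS1StubLZdetTwin

/-!
# NODE O port PT-A — ★★★ THE BRICK `lzHalfReg_of_P0C_of_classP2` (★★★ director-ym №627a (1′) ∕ №630 (3), g11 docket 1, part D): the v3.7 stub type `PortRecordLZHalfReg F` — the WHOLE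
# `log Z^{(k)}` half of (2.12) in Thm 3's format AT EVERY POINT of print's ε₀-class — FROM the P0-ℂ letter `P0HolExtAtRecordGL` and the three print-shaped CLASS letters ✓`ClassP2Reg`,
# ✓`ClassP5Reg`, ✓`ClassNestsUc` (all DISPLAYED; everything else — the δ-Jacobian half, `stub_G3C`'s pieces with pointwise (g1), the power member's integer twin, the letter at `V^{(k)}_{ax}(W_B)`,
# positivity of the Jacobian determinants on the class — a THEOREM)

Cell `ym-nodeO-ideate`, porter seat PT-A-1 (gen 11); `--kind proof --supports stmt-QuantumFields-27930 --as helper`; count-neutral.  [I] = [Balaban1987RG1]; [16] = [Balaban1985UV3];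
[15] = [Balaban1985Variational].

THE QUANTIFIER WALK (✓`lzdetHalf_of_twin_GL`'s, re-run with the class letters): `(c₀, γ₀, γ₁, δ₁)` from the P0 letter · `κt := 4κ₀(64,8) + 2` · ✓`g3cPiecesAt_pointwise` ⇒ `δG, Mth'` ·
`δ₀ := max δG (8κ₀(64,8) + 4)` · the P0 letter ⇒ `Mth(δ₀)` · `max Mth Mth'` · at `Mc`: `Bc` · at `a₀`: the TokE radius `ε₁ := min a₁ (a₀∕B₃)` from the half's own binder, the P0 letter ⇒ `α₀ α₁` ·
at `ε₂₉`: the three class radii `ε₂ ε₅ εN` of `ClassP2Reg` ∕ `ClassP5Reg` ∕ `ClassNestsUc` at `(Mc, a₀, ε₂₉, δ₀, c₀, γ₀, γ₁, α₀, α₁)`, the twins' radius `ε_cl := min (ε₁∕2) (1∕(53581824·L⁶))`,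
THE CLASS RADIUS `δcls := min (min ε₂ ε₅) (min εN ε_cl)`; `R := max (2γ₁) (16c₀·64K₀·e^{δ₀})`, `E₁`, `κ` as in the germ glue · at `k`: carriers, pieces (pointwise (g1)), twin, ✓`lzdetResidueOnReg_of_carriers`.
* §1 ★★★ `lzdetResidueOnReg` — the Gaussian half `phiLZdet` on the class from `P0HolExtAtRecordGL F`, `ClassP2Reg F`, `ClassP5Reg F`, `ClassNestsUc F` (the twin from ✓`stub_LZdetTwin`).
* §2 ★★★ `lzHalfReg_of_P0C_of_classP2 : (∀F, P0HolExtAtRecordGL F) → (∀F, ClassP2Reg F) → (∀F, ClassP5Reg F) → (∀F, ClassNestsUc F) → ∀F, PortRecordLZHalfReg F` — §1 + ✓`lzjacResidueOnReg`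
  (UNCONDITIONAL), radii ∕ class radii ∕ rates by `min`, constants added (✓`residueOnRegAtW_add` ∕ `_anti_radii` ∕ `_mono` ∕ `_anti_eps` ∕ `representsOnRegW_congr`, `phiLZ = phiLZjac + phiLZdet`).

HONEST FRAMING.  One `obtain` chain over DISPLAYED letters — `P0HolExtAtRecordGL` (= `stub_P0C`, node00-def-Y's M2-ℂ scheme), `ClassP2Reg`, `ClassP5Reg`, `ClassNestsUc` (print's (2.11)–(2.12) and
p.263 L5–13 «on U_k(ε₀)»; by-products of the same P0C ∕ P0-ℝ supply; inhabited NOWHERE) — and the tree's own theorems; `stub_LZhalfReg` is thereby CLOSED MODULO those four letters (no `sorry`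
replaced in the registry: the stub stays OPEN until the letters are inhabited); nothing of Bałaban's RG estimates asserted, ported or discharged; ⟨27930⟩ OPEN 1∕4 · no claim; ⟨26900⟩ 0∕4; NODE O 0∕1;
COUNT 8∕28 · K 1∕4 UNMOVED; finite `𝕋⁴_{L^K}` at fixed ε — NOT continuum ∕ OS; **the Yang–Mills mass gap (Clay) is NOT proved by any of this.**  No `sorry`, no `def`, no `instance`; standard axioms.
-/

noncomputable section

open scoped BigOperators Matrix.Norms.L2Operator Topology

namespace Summit.QuantumFields.YangMills.Theorems.BalabanUVNodesPortS1

open Summit.QuantumFields.YangMills.Theorems.K0RecordFormatNames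
open Literature.MathematicalPhysics.QuantumFieldTheory.Balaban1983to89
open Literature.MathematicalPhysics.QuantumFieldTheory.Balaban1983to89.Node00
open Literature.MathematicalPhysics.QuantumFieldTheory.Balaban1983to89.T4Continuum (T4Family)
open Literature.MathematicalPhysics.QuantumFieldTheory.Balaban1983to89.B12TreeDecay (K₀ kappa₀)

variable (F : T4Family)

/-! ## §1  ★★★ The Gaussian half on the class from the four letters -/

/-- ★★★ **THE GAUSSIAN HALF `phiLZdet` ON PRINT's ε₀-CLASS FROM THE P0-ℂ LETTER AND THE THREE CLASS LETTERS**: under `McGuard`, `2L² ≤ B₃`, `0 < a₀`, `0 < a₁` and ⁸'s TokE token, for every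
`ε₂₉ > 0` there are k-UNIFORM `E₁ ≥ 0`, `κ ≥ 4κ₀(64,8)`, radii `α₀ α₁ > 0` and a CLASS RADIUS `δcls > 0` with, at every `k`, ONE integer formula + wrap pieces representing `phiLZdet` in Thm 3's
format AT EVERY POINT of `InRegClass … δcls` (the walk of the file header). [cite: Balaban1985UV3, (63) p.272, (23)–(25) p.262; Balaban1987RG1, (2.11)–(2.14) pp.267–268, (1.18)–(1.19) p.263,
(1.21) p.264, (1.1)–(1.2) p.260, p.263 L5–13; Balaban1985Variational, Prop. 9 p.309, Thm 1 p.279] -/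
theorem lzdetResidueOnReg (hP : P0HolExtAtRecordGL F) (hC2 : ClassP2Reg F) (hC5 : ClassP5Reg F) (hN : ClassNestsUc F) :
    ∃ Mth : ℕ, ∀ Mc : ℕ, Mth ≤ Mc → McGuard F Mc →
    ∀ (B₃ a₀ a₁ : ℝ), 2 * (F.L : ℝ) ^ 2 ≤ B₃ → 0 < a₀ → 0 < a₁ →
    (∀ ε₁ : ℝ, 0 < ε₁ → ε₁ ≤ a₁ → B₃ * ε₁ ≤ a₀ → ∀ (k n : ℕ) (V : GaugeField (F.P (recordK₀ F Mc k + n)) (k + 1) (SU 2)), PlaqSmall ε₁ V →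
      UkExists F 2 (recordK₀ F Mc k + n) (k + 1) a₀ V ∧ UniqueUkOrbit F 2 (recordK₀ F Mc k + n) (k + 1) a₀ V) →
    ∀ ε₂₉ : ℝ, 0 < ε₂₉ → ∃ E₁ κ α₀ α₁ δ₀ : ℝ, 0 ≤ E₁ ∧ 4 * kappa₀ (4 * 2 ^ 4) (2 * 4) ≤ κ ∧ 0 < α₀ ∧ 0 < α₁ ∧ 0 < δ₀ ∧
      ∀ k : ℕ, ∃ (Ψ : IntLocalFormula (F.L ^ (k + 1) * Mc)) (Ew : TorusPieces F Mc k),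
        Ψ.ResidueOnRegAtW F Mc k Ew a₀ ε₂₉ α₀ α₁ δ₀ E₁ κ (phiLZdet F Mc a₀ ε₂₉ k) := by
  obtain ⟨c₀, γ₀, γ₁, δ₁, hc₀, hγ₀, hγ, hδ₁, HP⟩ := hP
  have hγ₁ : 0 < γ₁ := hγ₀.trans_le hγ
  have hκ₈0 : 0 ≤ kappa₀ (4 * 2 ^ 4) (2 * 4) := B12TreeDecay.kappa₀_nonneg (by norm_num) _
  have hκt0 : 0 < 4 * kappa₀ (4 * 2 ^ 4) (2 * 4) + 2 := by positivity
  obtain ⟨δG, hδG, Mth', HG⟩ := g3cPiecesAt_pointwise F (4 * kappa₀ (4 * 2 ^ 4) (2 * 4) + 2) hκt0 c₀ γ₀ γ₁ δ₁ hc₀ hγ₀ hγ hδ₁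
  obtain ⟨δ₀, hδ₀G, hδ₀8⟩ : ∃ δ₀ : ℝ, δG ≤ δ₀ ∧ 8 * kappa₀ (4 * 2 ^ 4) (2 * 4) + 4 ≤ δ₀ := ⟨max δG _, le_max_left _ _, le_max_right _ _⟩
  have hδ₀pos : 0 < δ₀ := hδG.trans_le hδ₀G
  obtain ⟨Mth, HM⟩ := HP δ₀ hδ₀pos
  refine ⟨max Mth Mth', fun Mc hMc hGuard B₃ a₀ a₁ hB₃ ha₀ ha₁ hUk ε₂₉ hε => ?_⟩
  obtain ⟨Bc, hBc, HB⟩ := HG δ₀ hδ₀G Mc ((le_max_right _ _).trans hMc) hGuard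
  -- the a₀-guard, discharged from the half's own TokE binder at ε₁ := min a₁ (a₀ ∕ B₃)
  have hB₃pos : 0 < B₃ := by
    have hL : (1 : ℝ) ≤ F.L := by exact_mod_cast F.hL.2.le
    nlinarith
  set ε₁ : ℝ := min a₁ (a₀ / B₃) with hε₁def
  have hε₁ : 0 < ε₁ := lt_min ha₁ (div_pos ha₀ hB₃pos)
  have hTokE := hUk ε₁ hε₁ (min_le_left _ _) (by
    calc B₃ * min a₁ (a₀ / B₃) ≤ B₃ * (a₀ / B₃) := mul_le_mul_of_nonneg_left (min_le_right _ _) hB₃pos.le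
      _ = a₀ := by field_simp)
  obtain ⟨α₀, α₁, hα₀, hα₁, HK⟩ := HM Mc ((le_max_left _ _).trans hMc) hGuard a₀ ha₀ ⟨_, hε₁, hTokE⟩
  -- the three class radii and the twins' radius
  obtain ⟨ε₂, hε₂, HC2⟩ := hC2 Mc a₀ ε₂₉ δ₀ c₀ γ₀ γ₁ α₀ α₁ hGuard ha₀ hε
  obtain ⟨ε₅, hε₅, HC5⟩ := hC5 Mc a₀ ε₂₉ δ₀ c₀ γ₀ γ₁ α₀ α₁ hGuard ha₀ hε
  obtain ⟨εN, hεN, HN⟩ := hN Mc a₀ ε₂₉ α₀ α₁ hGuard ha₀ hε hα₀ hα₁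
  set εcl : ℝ := min (ε₁ / 2) (1 / (53581824 * (F.L : ℝ) ^ 6)) with hεcldef
  have hLpos : (0 : ℝ) < F.L := by exact_mod_cast F.hL.2.le.trans_lt' (by norm_num)
  have hεcl : 0 < εcl := lt_min (half_pos hε₁) (by positivity)
  set δcls : ℝ := min (min ε₂ ε₅) (min εN εcl) with hδclsdef
  have hδcls : 0 < δcls := lt_min (lt_min hε₂ hε₅) (lt_min hεN hεcl)
  have hδ2 : δcls ≤ ε₂ := (min_le_left _ _).trans (min_le_left _ _)
  have hδ5 : δcls ≤ ε₅ := (min_le_left _ _).trans (min_le_right _ _)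
  have hδN : δcls ≤ εN := (min_le_right _ _).trans (min_le_left _ _)
  have hδcl : δcls ≤ εcl := (min_le_right _ _).trans (min_le_right _ _)
  have hδclsc : δcls ≤ 1 / (53581824 * (F.L : ℝ) ^ 6) := hδcl.trans (min_le_right _ _)
  have hδclsε : 2 * δcls ≤ ε₁ := by have := hδcl.trans (min_le_left _ _); linarith
  -- the radius of [16] (63)
  obtain ⟨R, hR₁, hRc⟩ : ∃ R : ℝ, 2 * γ₁ ≤ R ∧ 2 * ((2 * c₀) * (4 * 2 ^ 4 * K₀ (4 * 2 ^ 4) (2 * 4)) * Real.exp δ₀) ≤ R :=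
    ⟨max _ _, le_max_left _ _, le_max_right _ _⟩
  have hR : 0 < R := lt_of_lt_of_le (by positivity) hR₁
  refine ⟨2 * (13 * 4 ^ 4 * (R * Bc + ((3 * 4 * (F.L * Mc) ^ 4 : ℕ) : ℝ))), min (4 * kappa₀ (4 * 2 ^ 4) (2 * 4) + 2) (δ₀ / 2) - 2, α₀, α₁, δcls,
    by positivity, ?_, hα₀, hα₁, hδcls, fun k => ?_⟩
  · have h2 : 4 * kappa₀ (4 * 2 ^ 4) (2 * 4) + 2 ≤ δ₀ / 2 := by
      set κ₈ := kappa₀ (4 * 2 ^ 4) (2 * 4) with hκ₈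
      linarith
    have h3 : 4 * kappa₀ (4 * 2 ^ 4) (2 * 4) + 2 ≤ min (4 * kappa₀ (4 * 2 ^ 4) (2 * 4) + 2) (δ₀ / 2) := le_min le_rfl h2
    set κ₈ := kappa₀ (4 * 2 ^ 4) (2 * 4) with hκ₈
    set m := min (4 * κ₈ + 2) (δ₀ / 2) with hm
    linarith
  · obtain ⟨TC, TY, TZY, AdM, AdZ, hPC, hLat⟩ := HK ε₂₉ hε k
    obtain ⟨EG, EGZ, hG3, hg1pt⟩ := HB a₀ α₀ α₁ ε₂₉ ha₀ hα₀ hα₁ hε k TC TY TZY AdM AdZ hPC hLat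
    obtain ⟨ΨP, hΨP⟩ := stub_LZdetTwin F Mc hGuard a₀ δ₀ c₀ γ₀ γ₁ α₀ α₁ ε₂₉ k TC TY TZY AdM AdZ hPC R
    have hδ : kappa₀ (4 * 2 ^ 4) (2 * 4) ≤ δ₀ / 2 - 1 := by
      set κ₈ := kappa₀ (4 * 2 ^ 4) (2 * 4) with hκ₈
      linarith
    exact lzdetResidueOnReg_of_carriers F hGuard k ha₀ hα₀ hα₁ hc₀ hγ₁ hBc hR hR₁ hδ hRc hδcls hδclsc hδclsε (hTokE k)
      TC TY TZY AdM AdZ hPC EG EGZ hG3 hg1pt ΨP hΨP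
      (fun n B hB => HC2 k TC TY TZY AdM AdZ hPC n B (inRegClass_mono hδ2 hB))
      (fun n B hB => HC5 k TC TY TZY AdM AdZ hPC n B (inRegClass_mono hδ5 hB))
      (fun n B hB => HN k n B (inRegClass_mono hδN hB))

/-! ## §2  ★★★ The brick: `PortRecordLZHalfReg F` from the four letters -/

/-- ★★★ **`lzHalfReg_of_P0C_of_classP2`** — THE LZ HALF OF (2.12) IN THM 3's FORMAT ON PRINT's ε₀-CLASS (v3.7's `stub_LZhalfReg` type) FROM `stub_P0C`'s letter AND THE THREE CLASS LETTERS: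
`(∀F, P0HolExtAtRecordGL F) → (∀F, ClassP2Reg F) → (∀F, ClassP5Reg F) → (∀F, ClassNestsUc F) → ∀F, PortRecordLZHalfReg F` — the δ-Jacobian half UNCONDITIONAL on the class
(✓`lzjacResidueOnReg`), the Gaussian half by §1; `phiLZ = phiLZjac + phiLZdet`; radii, rates and CLASS RADII meet at `min`, constants add.
[cite: Balaban1987RG1, (1.4) p.260, (1.6)–(1.7) p.261, (1.18)–(1.19) p.263, (1.21) p.264, (2.11)–(2.12) pp.267–268, (1.1)–(1.2) p.260, p.263 L5–13; Balaban1985UV3, (63) p.272;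
Balaban1985Variational, Thm 1 p.279, Prop. 9 p.309] -/
theorem lzHalfReg_of_P0C_of_classP2 (hP : ∀ F, P0HolExtAtRecordGL F) (hC2 : ∀ F, ClassP2Reg F) (hC5 : ∀ F, ClassP5Reg F) (hN : ∀ F, ClassNestsUc F) :
    ∀ F, PortRecordLZHalfReg F := by
  intro F
  obtain ⟨M₁, H₁⟩ := lzjacResidueOnReg F
  obtain ⟨M₂, H₂⟩ := lzdetResidueOnReg F (hP F) (hC2 F) (hC5 F) (hN F)
  refine ⟨max M₁ M₂, fun Mc hMc j c cc₀ c₁ B₃ B₃' a₀ a₁ hGuard _ _ _ hB₃ _ ha₀ ha₁ _ _ hUk _ _ ε₂₉ hε => ?_⟩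
  obtain ⟨E₁, κ₁, α₀, α₁, δ₁, hE₁, hκ₁, hα₀, hα₁, hδ₁, HJ⟩ := H₁ Mc (le_of_max_le_left hMc) hGuard B₃ a₀ a₁ hB₃ ha₀ ha₁ hUk ε₂₉
  obtain ⟨E₂, κ₂, β₀, β₁, δ₂, hE₂, hκ₂, hβ₀, hβ₁, hδ₂, HD⟩ := H₂ Mc (le_of_max_le_right hMc) hGuard B₃ a₀ a₁ hB₃ ha₀ ha₁ hUk ε₂₉ hε
  refine ⟨E₁ + E₂, min κ₁ κ₂, min α₀ β₀, min α₁ β₁, min δ₁ δ₂, add_nonneg hE₁ hE₂, le_min hκ₁ hκ₂, lt_min hα₀ hβ₀, lt_min hα₁ hβ₁, lt_min hδ₁ hδ₂, fun k => ?_⟩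
  obtain ⟨Ψ₁, Ew₁, hR₁⟩ := HJ k
  obtain ⟨Ψ₂, Ew₂, hR₂⟩ := HD k
  have h := residueOnRegAtW_add F Ψ₁ Ψ₂ Ew₁ Ew₂ a₀ ε₂₉ (min α₀ β₀) (min α₁ β₁) (min δ₁ δ₂) E₁ E₂ (min κ₁ κ₂) (phiLZjac F Mc a₀ ε₂₉ k) (phiLZdet F Mc a₀ ε₂₉ k)
    (residueOnRegAtW_anti_eps (residueOnRegAtW_anti_radii (residueOnRegAtW_mono hR₁ le_rfl (min_le_left _ _) hE₁) (min_le_left _ _) (min_le_left _ _)) (min_le_left _ _))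
    (residueOnRegAtW_anti_eps (residueOnRegAtW_anti_radii (residueOnRegAtW_mono hR₂ le_rfl (min_le_right _ _) hE₂) (min_le_right _ _) (min_le_right _ _)) (min_le_right _ _))
  refine ⟨Ψ₁.add Ψ₂, fun n X φ => Ew₁ n X φ + Ew₂ n X φ, h.1, h.2.1, h.2.2.1, h.2.2.2.1, h.2.2.2.2.1, h.2.2.2.2.2.1, ?_⟩
  exact representsOnRegW_congr F _ _ a₀ ε₂₉ (min δ₁ δ₂) (phiLZ F Mc a₀ ε₂₉ k) (fun n B => phiLZjac F Mc a₀ ε₂₉ k n B + phiLZdet F Mc a₀ ε₂₉ k n B)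
    (fun n B => phiLZjac_add_phiLZdet F Mc a₀ ε₂₉ k n B) h.2.2.2.2.2.2

end Summit.QuantumFields.YangMills.Theorems.BalabanUVNodesPortS1

end
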